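import Summits.CriticalPhenomena.PercolationContinuityZ3.Theorems.SahiBoxTP2BooleanSpins
import Summits.CriticalPhenomena.PercolationContinuityZ3.Theorems.SahiFKGBondMeasures
import Summits.CriticalPhenomena.PercolationContinuityZ3.Theorems.PercNearOneGluingNoHeavyLowerTailSahiCubeThreeAllOrders

/-!
# Unconditional layers in infinite volume: observables of few coordinates of a box-TP₂ law

Support file of the Sahi cell (`prim-sahi`, typer seat, generation 12; `--supports stmt-CriticalPhenomena-4575`).
Kernel-only (no computational certificate).

Box-TP₂ passes to the law of ANY sub-family of coordinates (`IsBoxTP2.map_restrictComp`, a box pulling back to a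
box — for singular laws, unlike Karlin–Rinott's marginal theorem for MTP₂ densities, no integration is needed).  Hence
the proved finite-dimensional cells give UNCONDITIONAL statements for observables of few coordinates of an
infinite-dimensional box-TP₂ law, for an arbitrary index type `ι`:

* `msahiE_nonneg_of_isBoxTP2_comp_le_two` — `[0,1]`-valued coordinates, families of functions of the same `d ≤ 2`
  coordinates: `E_n ≥ 0` for EVERY `n` (Lieb–Sahi's two-dimensional theorem, `liebSahiContinuum_of_le_two`, through
  generation 11's `msahiE_nonneg_of_isBoxTP2_of_le_two`).
* `msahiE_nonneg_of_isBoxTP2_spins_comp_three` — `{0,1}`-valued coordinates, functions of the same THREE coordinates: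
  `E_n ≥ 0` for EVERY `n` (the cell's theorem `SahiCubeAllOrders.sahiPositive_cube_three`: every FKG weight on `{0,1}³`
  is Sahi-positive of all orders; the three-coordinate marginal of a box-TP₂ law has FKG-lattice point weights,
  `isFKGMeasure_real_singleton_of_isBoxTP2`).

(Order `3` for three `[0,1]`-valued coordinates is the computational `(3,3)` cell, `SahiBoxTP2GridThree.lean`.)
No sorries, no new axioms.
-/

noncomputable section

namespace Summit.CriticalPhenomena.PercolationContinuityZ3.Theorems.SahiBoxTP2

open MeasureTheory ProbabilityTheory Set Filter Topology Function Literature.Combinatorics.Sahi2008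
open scoped ENNReal unitInterval

/-! ### `[0,1]`-valued coordinates: two coordinates, every order -/

section UnitInterval

variable {ι : Type*} {n d : ℕ}

/-- **Functions of at most two `[0,1]`-valued coordinates of a box-TP₂ law satisfy `E_n ≥ 0` for every `n`**
(unconditional: the law of the two coordinates is box-TP₂ on `Q_2`, where Lieb–Sahi's theorem holds). [this work] -/
theorem msahiE_nonneg_of_isBoxTP2_comp_le_two (hd : d ≤ 2) (μ : Measure (ι → I)) [IsProbabilityMeasure μ]
    (hμ : IsBoxTP2 μ) {j : Fin d → ι} (hj : Injective j) (g : Fin n → (Fin d → I) → ℝ)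
    (hgm : ∀ i, Measurable (g i)) (hg0 : ∀ i x, 0 ≤ g i x) (hmono : ∀ i, Monotone (g i)) :
    0 ≤ msahiE μ n (fun i u => g i (u ∘ j)) := by
  have hr : Measurable fun u : ι → I => u ∘ j := measurable_pi_lambda _ fun k => measurable_pi_apply (j k)
  haveI : IsProbabilityMeasure (μ.map fun u : ι → I => u ∘ j) := Measure.isProbabilityMeasure_map hr.aemeasurable
  have hmp : MeasurePreserving (fun u : ι → I => u ∘ j) μ (μ.map fun u : ι → I => u ∘ j) := ⟨hr, rfl⟩
  have key := msahiE_nonneg_of_isBoxTP2_of_le_two hd (μ.map fun u : ι → I => u ∘ j)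
    (hμ.map_restrictComp hj fun _ _ => measurableSet_Icc) n g hgm hg0 hmono
  rwa [← msahiE_comp_measurePreserving_of_measurable hmp n g hgm] at key

/-- The same for antitone families. [this work] -/
theorem msahiE_nonneg_of_isBoxTP2_comp_le_two_antitone (hd : d ≤ 2) (μ : Measure (ι → I)) [IsProbabilityMeasure μ]
    (hμ : IsBoxTP2 μ) {j : Fin d → ι} (hj : Injective j) (g : Fin n → (Fin d → I) → ℝ)
    (hgm : ∀ i, Measurable (g i)) (hg0 : ∀ i x, 0 ≤ g i x) (hanti : ∀ i, Antitone (g i)) :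
    0 ≤ msahiE μ n (fun i u => g i (u ∘ j)) := by
  have hr : Measurable fun u : ι → I => u ∘ j := measurable_pi_lambda _ fun k => measurable_pi_apply (j k)
  haveI : IsProbabilityMeasure (μ.map fun u : ι → I => u ∘ j) := Measure.isProbabilityMeasure_map hr.aemeasurable
  have hmp : MeasurePreserving (fun u : ι → I => u ∘ j) μ (μ.map fun u : ι → I => u ∘ j) := ⟨hr, rfl⟩
  have key := msahiE_nonneg_of_isBoxTP2_antitone (liebSahiContinuum_of_le_two hd n) (μ.map fun u : ι → I => u ∘ j)
    (hμ.map_restrictComp hj fun _ _ => measurableSet_Icc) g hgm hg0 hanti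
  rwa [← msahiE_comp_measurePreserving_of_measurable hmp n g hgm] at key

end UnitInterval

/-! ### `{0,1}`-valued coordinates: three coordinates, every order -/

section Spins

variable {ι : Type*} {n : ℕ}

/-- **The point weights of a box-TP₂ probability measure on a finite lattice form an FKG weight** (singletons are
boxes). [folklore] -/
theorem isFKGMeasure_real_singleton_of_isBoxTP2 {α : Type*} [Lattice α] [Fintype α] [MeasurableSpace α]
    [MeasurableSingletonClass α] (ν : Measure α) [IsProbabilityMeasure ν] (hν : IsBoxTP2 ν) :
    IsFKGMeasure (fun a : α => ν.real {a}) where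
  nonneg a := measureReal_nonneg
  sum_eq_one := by
    classical
    have h := measureReal_eq_sum_filter ν (univ : Set α)
    rw [Finset.filter_true_of_mem (fun x _ => mem_univ x), probReal_univ] at h
    exact h.symm
  mul_le_mul a b := by
    have h := hν a a b b
    simp only [Icc_self] at h
    rw [measureReal_def, measureReal_def, measureReal_def, measureReal_def, ← ENNReal.toReal_mul,
      ← ENNReal.toReal_mul]
    exact ENNReal.toReal_mono (ENNReal.mul_ne_top (measure_ne_top ν _) (measure_ne_top ν _)) h

/-- **Functions of the same three `{0,1}`-valued coordinates of a box-TP₂ law on `{0,1}^ι` satisfy `E_n ≥ 0` for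
EVERY `n`** (unconditional: the three-coordinate marginal has FKG-lattice point weights on `{0,1}³`, where Sahi's
conjecture holds at every order, `SahiCubeAllOrders.sahiPositive_cube_three`). [this work] -/
theorem msahiE_nonneg_of_isBoxTP2_spins_comp_three (μ : Measure (ι → Bool)) [IsProbabilityMeasure μ]
    (hμ : IsBoxTP2 μ) {j : Fin 3 → ι} (hj : Injective j) (g : Fin n → (Fin 3 → Bool) → ℝ)
    (hg0 : ∀ i x, 0 ≤ g i x) (hmono : ∀ i, Monotone (g i)) : 0 ≤ msahiE μ n (fun i u => g i (u ∘ j)) := by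
  have hr : Measurable fun u : ι → Bool => u ∘ j := measurable_pi_lambda _ fun k => measurable_pi_apply (j k)
  haveI : IsProbabilityMeasure (μ.map fun u : ι → Bool => u ∘ j) := Measure.isProbabilityMeasure_map hr.aemeasurable
  have hmp : MeasurePreserving (fun u : ι → Bool => u ∘ j) μ (μ.map fun u : ι → Bool => u ∘ j) := ⟨hr, rfl⟩
  have hν : IsBoxTP2 (μ.map fun u : ι → Bool => u ∘ j) :=
    hμ.map_restrictComp hj fun a b => (Set.toFinite _).measurableSet
  have hw := isFKGMeasure_real_singleton_of_isBoxTP2 _ hν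
  have key : 0 ≤ msahiE (μ.map fun u : ι → Bool => u ∘ j) n g := by
    rw [SahiFKGBondMeasures.msahiE_eq_sahiE_real_singleton]
    exact SahiCubeAllOrders.sahiPositive_cube_three hw n g hg0 hmono
  rwa [← msahiE_comp_measurePreserving_of_measurable hmp n g fun i => Measurable.of_discrete] at key

/-- With FKG-lattice finite-dimensional marginals on `{0,1}^ℕ` (the hypothesis of `isBoxTP2_of_fkg_marginals`):
functions of three coordinates have `E_n ≥ 0` for every `n`, unconditionally. [this work] -/
theorem msahiE_nonneg_of_fkg_marginals_comp_three (μ : Measure (ℕ → Bool)) [IsProbabilityMeasure μ]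
    (hfkg : ∀ (d : ℕ) (x y : Fin d → Bool),
      μ.real {u | finRestrict d u = x} * μ.real {u | finRestrict d u = y} ≤
        μ.real {u | finRestrict d u = x ⊓ y} * μ.real {u | finRestrict d u = x ⊔ y})
    {j : Fin 3 → ℕ} (hj : Injective j) (g : Fin n → (Fin 3 → Bool) → ℝ) (hg0 : ∀ i x, 0 ≤ g i x)
    (hmono : ∀ i, Monotone (g i)) : 0 ≤ msahiE μ n (fun i u => g i (u ∘ j)) :=
  msahiE_nonneg_of_isBoxTP2_spins_comp_three μ (isBoxTP2_of_fkg_marginals μ hfkg) hj g hg0 hmono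

end Spins

end Summit.CriticalPhenomena.PercolationContinuityZ3.Theorems.SahiBoxTP2
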